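import Summits.ResolutionOfSingularities.ResolutionOfSingularities.Theorems.FrobeniusClosingPatchingRelPerfectPointwiseMonomialTransform
import Summits.ResolutionOfSingularities.ResolutionOfSingularities.Theorems.FrobeniusClosingPatchingRelPerfectMonomialPairStep
import HarnessLib

/-!
# Crux `PatchingRelPerfect` (stmt-ResolutionOfSingularities-16161), chain W5.2 — TargetsF5J, S-target
# `PointwisePairGame`, part 2: ONE STEP of the pair game, with simple normal crossings read only at the
# points of the cosupport

[OURS · L1 W5.2 · rung tool] Replaces the role of NO printed item; NOT a statement of the manuscript under
review; fact-free, any dimension, no base field, no excellence.  Verbatim res-L1-w52-stub-4's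
`MonomialCleanup.step_classify` / `MonomialCleanup.exists_step` (`…MonomialPairStep`, p504028's chain), with the GLOBAL hypothesis
`HasSNC (boundaryOf A)` replaced by the POINTWISE one
`∀ x ∈ supp(monomialIdeal A ⊔ monomialIdeal B), DepthSNC.SNCWithAt (boundaryOf A) ⊤ x`
(res-D-pv-009's predicate): every snc read of the original happens at a point over the cosupport — the
centre `V(K) ∩ V(L)` of a bad pair lies in it (`mem_support_sup_of_isBadPair`), the witness point of a new
bad pair lies in the new cosupport `= π⁻¹` of the old one, and the transformed boundary is snc at the points
of the new cosupport by `IsBlowup.sncWithAt_transform` (p511317).  The snc-free combinatorics (`badPairs`,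
`value`, `maxVal`, `numMax`, `expOf`, `transformExp`, `pre`, …) are stub-4's / the tree's, used by name.

## References
* J. Kollár, *Lectures on Resolution of Singularities* (2007), (3.111) Step 3, Def. 3.25. [Kollar2007]
* R. Goward, *A simple algorithm for principalization of monomial ideals*, Trans. AMS 357 (2005), §2. [Goward2005]
-/

-- `Summit.<Summit>.<Sub>.Theorems` with `Sub = Summit` (single-conjunct summit, D-0017)
set_option linter.dupNamespace false

noncomputable section

open CategoryTheory AlgebraicGeometry TopologicalSpace IsLocalRing
open Literature.AlgebraicGeometry.Resolution

namespace Summit.ResolutionOfSingularities.ResolutionOfSingularities.Theorems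

universe u

namespace PointwisePair

open DepthSNC MonomialCleanup

/-! ## §1 Exponents after blowing up a stratum, snc read at the points of the centre -/

section Exponents

variable {X X' : Scheme.{u}} [IsLocallyNoetherian X] {π : X' ⟶ X}
  {E : List (X.IdealSheafData × ℕ)} {T : Finset X.IdealSheafData} {m : ℕ}
  (hW : ∀ x ∈ (T.sup id).support, SNCWithAt (boundaryOf E) ⊤ x) (hT : ∀ K ∈ T, K ∈ boundaryOf E)
  (hπ : IsBlowup π (T.sup id))
include hW hT hπ

/-- Behind a strict transform with a point (over a point of simple normal crossings) there is exactly one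
old divisor. [folklore] -/
theorem pre_singleton_strictTransform_pw {K₀ : X.IdealSheafData} (hK₀ : K₀ ∈ sheaves E) {x' : X'}
    (hx'W : SNCWithAt (boundaryOf E) ⊤ (π x'))
    (hx' : x' ∈ (strictTransformIdeal π (T.sup id) K₀).support) :
    pre E π T {strictTransformIdeal π (T.sup id) K₀} = {K₀} := by
  ext K
  simp only [mem_pre_iff, Finset.mem_singleton]
  constructor
  · rintro ⟨hK, heq⟩
    have hxK : x' ∈ (strictTransformIdeal π (T.sup id) K).support := by rw [heq]; exact hx'
    exact eq_of_strictTransformIdeal_eq_pw hW hT hπ (mem_sheaves_iff.mp hK) (mem_sheaves_iff.mp hK₀)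
      hx'W hxK heq
  · rintro rfl
    exact ⟨hK₀, rfl⟩

/-- **The exponent of a strict transform** (at any of its points over a point of simple normal crossings)
is the old exponent. [cite: Kollar2007, (3.111) Step 3] -/
theorem expOf_transformExp_strictTransform_pw {K₀ : X.IdealSheafData} (hK₀ : K₀ ∈ sheaves E) {x' : X'}
    (hx'W : SNCWithAt (boundaryOf E) ⊤ (π x'))
    (hx' : x' ∈ (strictTransformIdeal π (T.sup id) K₀).support) :
    expOf (transformExp E π T m) (strictTransformIdeal π (T.sup id) K₀) = expOf E K₀ := by
  classical
  have hne : (T.sup id).comap π ∉ ({strictTransformIdeal π (T.sup id) K₀} : Finset X'.IdealSheafData) := by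
    rw [Finset.mem_singleton]
    intro h
    have hx'F : x' ∈ ((T.sup id).comap π).support := by rw [h]; exact hx'
    exact strictTransformIdeal_ne_comap_pw hW hT hπ (mem_sheaves_iff.mp hK₀) hx'F h.symm
  rw [expOf, weightOf_transformExp, pre_singleton_strictTransform_pw hW hT hπ hK₀ hx'W hx', if_neg hne,
    add_zero]
  rfl

end Exponents

/-! ## §2 One step: blowing up a well-chosen bad pair, snc read at the points of the cosupport -/

section Step

variable {X : Scheme.{u}} [IsLocallyNoetherian X] {A B : List (X.IdealSheafData × ℕ)}

omit [IsLocallyNoetherian X] in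
/-- The stratum of a bad pair lies in the cosupport, so the pointwise hypothesis on the cosupport restricts
to it. [folklore] -/
theorem sncWithAt_of_mem_support_finsetSup {K L : X.IdealSheafData}
    (hS : ∀ x ∈ (monomialIdeal A ⊔ monomialIdeal B).support, SNCWithAt (boundaryOf A) ⊤ x)
    (hKA : K ∈ sheaves A) (hLB : L ∈ sheaves B) (hbad : IsBadPair A B K L)
    {T : Finset X.IdealSheafData} (hTKL : ∀ G, G ∈ T ↔ G = K ∨ G = L) :
    ∀ x ∈ (T.sup id).support, SNCWithAt (boundaryOf A) ⊤ x := by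
  intro x hx
  have hx' := (mem_support_finsetSup_iff T x).mp hx
  exact hS x (mem_support_sup_of_isBadPair hKA hLB hbad (hx' K ((hTKL K).mpr (Or.inl rfl)))
    (hx' L ((hTKL L).mpr (Or.inr rfl))))

/-- **Classification of the bad pairs after the blow-up of the stratum of a well-chosen bad pair `(K, L)`**
(verbatim `MonomialCleanup.step_classify`, snc read at the points of the cosupport). [folklore] -/
theorem step_classify_pw
    (hS : ∀ x ∈ (monomialIdeal A ⊔ monomialIdeal B).support, SNCWithAt (boundaryOf A) ⊤ x)
    (hAB : boundaryOf A = boundaryOf B)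
    {K L : X.IdealSheafData} (hKL : (K, L) ∈ badPairs A B)
    (hKM : expOf A K - expOf B K = maxVal A B)
    (hLmax : ∀ H ∈ sheaves B, (K, H) ∈ badPairs A B → expOf B H - expOf A H ≤ expOf B L - expOf A L)
    {T : Finset X.IdealSheafData} (hTKL : ∀ G, G ∈ T ↔ G = K ∨ G = L)
    {X' : Scheme.{u}} {π : X' ⟶ X} (hπ : IsBlowup π (T.sup id))
    (p' : X'.IdealSheafData × X'.IdealSheafData)
    (hp' : p' ∈ badPairs (transformExp A π T 0) (transformExp B π T 0)) :
    value (transformExp A π T 0) (transformExp B π T 0) p' < maxVal A B ∨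
      ∃ p ∈ badPairs A B, p ≠ (K, L) ∧
        p' = (strictTransformIdeal π (T.sup id) p.1, strictTransformIdeal π (T.sup id) p.2) ∧
        value (transformExp A π T 0) (transformExp B π T 0) p' = value A B p := by
  classical
  set F : X'.IdealSheafData := (T.sup id).comap π with hFdef
  obtain ⟨hKA, hLB, hK1, hL1, hKLx⟩ := mem_badPairs_iff.mp hKL
  replace hKA : K ∈ sheaves A := hKA
  replace hLB : L ∈ sheaves B := hLB
  replace hK1 : expOf B K < expOf A K := hK1
  replace hL1 : expOf A L < expOf B L := hL1
  have hbad : IsBadPair A B K L := ⟨hK1, hL1, hKLx⟩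
  have hW : ∀ x ∈ (T.sup id).support, SNCWithAt (boundaryOf A) ⊤ x :=
    sncWithAt_of_mem_support_finsetSup hS hKA hLB hbad hTKL
  have hWB : ∀ x ∈ (T.sup id).support, SNCWithAt (boundaryOf B) ⊤ x := hAB ▸ hW
  have hKT : K ∈ T := (hTKL K).mpr (Or.inl rfl)
  have hLT : L ∈ T := (hTKL L).mpr (Or.inr rfl)
  have hSAB : sheaves A = sheaves B := sheaves_eq_of_boundaryOf_eq hAB
  have hTA : ∀ G ∈ T, G ∈ boundaryOf A := by
    intro G hG
    rcases (hTKL G).mp hG with rfl | rfl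
    · exact mem_sheaves_iff.mp hKA
    · exact mem_sheaves_iff.mp (hSAB ▸ hLB)
  have hTB : ∀ G ∈ T, G ∈ boundaryOf B := fun G hG => hAB ▸ hTA G hG
  have hKneL : K ≠ L := by rintro rfl; omega
  have hvalKL : expOf B L - expOf A L ≤ expOf A K - expOf B K := by
    have h := value_le_maxVal hKL
    rw [value, ← hKM] at h
    exact le_of_max_le_right h
  have hTeq : T = insert K {L} := by
    ext G
    rw [hTKL G, Finset.mem_insert, Finset.mem_singleton]
  have hwA : weightOf A T = expOf A K + expOf A L := by
    rw [hTeq, weightOf_insert A (by rwa [Finset.mem_singleton])]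
    rfl
  have hwB : weightOf B T = expOf B K + expOf B L := by
    rw [hTeq, weightOf_insert B (by rwa [Finset.mem_singleton])]
    rfl
  -- the new cosupport lies over the old one
  have hcosupp : ∀ {y : X'}, y ∈ (monomialIdeal (transformExp A π T 0) ⊔
      monomialIdeal (transformExp B π T 0)).support → π y ∈ (monomialIdeal A ⊔ monomialIdeal B).support := by
    intro y hy
    have h1 : y ∈ (((monomialIdeal A ⊔ monomialIdeal B).comap π).support : Set X') := by
      rw [Scheme.IdealSheafData.comap_sup, comap_monomialIdeal_eq_transformExp_pw hW hTA hπ,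
        comap_monomialIdeal_eq_transformExp_pw hWB hTB hπ]
      exact hy
    rw [Scheme.IdealSheafData.support_comap] at h1
    exact h1
  -- unpack the new bad pair
  obtain ⟨hG, hH, hGlt, hHlt, x', hxG, hxH⟩ := mem_badPairs_iff.mp hp'
  obtain ⟨G, H⟩ := p'
  simp only at hG hH hGlt hHlt hxG hxH ⊢
  -- the witness point lies over the cosupport, so the boundary is snc at its image
  have hx'S : π x' ∈ (monomialIdeal A ⊔ monomialIdeal B).support :=
    hcosupp (mem_support_sup_of_isBadPair hG hH ⟨hGlt, hHlt, x', hxG, hxH⟩ hxG hxH)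
  have hx'W : SNCWithAt (boundaryOf A) ⊤ (π x') := hS _ hx'S
  have hx'WB : SNCWithAt (boundaryOf B) ⊤ (π x') := hAB ▸ hx'W
  -- exponents of the exceptional divisor (at any of its points: no old divisor has `F` as strict transform)
  have hpre : ∀ {E : List (X.IdealSheafData × ℕ)}, (∀ x ∈ (T.sup id).support, SNCWithAt (boundaryOf E) ⊤ x) →
      (∀ G ∈ T, G ∈ boundaryOf E) → ∀ {y : X'}, y ∈ F.support →
        expOf (transformExp E π T 0) F = weightOf E T := by
    intro E hWE hTE y hy
    have h0 : pre E π T {F} = ∅ := by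
      ext K'
      simp only [mem_pre_iff, Finset.mem_singleton, Finset.notMem_empty, iff_false, not_and]
      exact fun hK h => strictTransformIdeal_ne_comap_pw hWE hTE hπ (mem_sheaves_iff.mp hK) hy h
    rw [expOf, weightOf_transformExp, h0, weightOf_empty, if_pos (Finset.mem_singleton_self _), zero_add,
      Nat.sub_zero]
  have hexpF : ∀ {y : X'}, y ∈ F.support →
      expOf (transformExp A π T 0) F = expOf A K + expOf A L ∧
        expOf (transformExp B π T 0) F = expOf B K + expOf B L := fun hy =>
    ⟨by rw [hpre hW hTA hy, hwA], by rw [hpre hWB hTB hy, hwB]⟩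
  -- `H` is not the exceptional divisor
  have hHF : H ≠ F := by
    intro hHF
    rw [hHF] at hHlt hxH
    obtain ⟨hA', hB'⟩ := hexpF hxH
    rw [hA', hB'] at hHlt
    omega
  -- so `H` is a strict transform
  obtain ⟨H₀, hH₀, hH₀eq, hxH₀⟩ : ∃ H₀ ∈ sheaves B, strictTransformIdeal π (T.sup id) H₀ = H ∧
      π x' ∈ H₀.support := by
    rcases eq_comap_or_exists_eq_strictTransform hH hxH with h | h
    · exact absurd h hHF
    · exact h
  have hexpH : expOf (transformExp A π T 0) H = expOf A H₀ ∧
      expOf (transformExp B π T 0) H = expOf B H₀ := by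
    rw [← hH₀eq] at hxH ⊢
    exact ⟨expOf_transformExp_strictTransform_pw hW hTA hπ (hSAB ▸ hH₀) hx'W hxH,
      expOf_transformExp_strictTransform_pw hWB hTB hπ hH₀ hx'WB hxH⟩
  by_cases hGF : G = F
  · -- the new pair is `(F, H₀')`: its value is `< M`
    left
    rw [hGF] at hGlt hxG ⊢
    obtain ⟨hAF, hBF⟩ := hexpF hxG
    -- `(K, H₀)` is an old bad pair, so `b_{H₀} - a_{H₀} ≤ b_L - a_L`
    have hxK : π x' ∈ K.support := by
      have h : π x' ∈ (T.sup id).support := by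
        have h' : x' ∈ (F.support : Set X') := hxG
        rw [hFdef, Scheme.IdealSheafData.support_comap] at h'
        exact h'
      exact (mem_support_finsetSup_iff T _).mp h K hKT
    have hKH₀ : (K, H₀) ∈ badPairs A B := by
      refine mem_badPairs_iff.mpr ⟨hKA, hH₀, hK1, ?_, π x', hxK, hxH₀⟩
      rw [hexpH.1, hexpH.2] at hHlt
      exact hHlt
    have hle := hLmax H₀ hH₀ hKH₀
    rw [value]
    simp only
    rw [hAF, hBF, hexpH.1, hexpH.2]
    rw [hAF, hBF] at hGlt
    omega
  · -- the new pair is `(G₀', H₀')` for an old bad pair `(G₀, H₀) ≠ (K, L)`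
    right
    obtain ⟨G₀, hG₀, hG₀eq, hxG₀⟩ : ∃ G₀ ∈ sheaves A, strictTransformIdeal π (T.sup id) G₀ = G ∧
        π x' ∈ G₀.support := by
      rcases eq_comap_or_exists_eq_strictTransform hG hxG with h | h
      · exact absurd h hGF
      · exact h
    have hexpG : expOf (transformExp A π T 0) G = expOf A G₀ ∧
        expOf (transformExp B π T 0) G = expOf B G₀ := by
      rw [← hG₀eq] at hxG ⊢
      exact ⟨expOf_transformExp_strictTransform_pw hW hTA hπ hG₀ hx'W hxG,
        expOf_transformExp_strictTransform_pw hWB hTB hπ (hSAB ▸ hG₀) hx'WB hxG⟩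
    refine ⟨(G₀, H₀), ?_, ?_, ?_, ?_⟩
    · refine mem_badPairs_iff.mpr ⟨hG₀, hH₀, ?_, ?_, π x', hxG₀, hxH₀⟩
      · rw [hexpG.1, hexpG.2] at hGlt; exact hGlt
      · rw [hexpH.1, hexpH.2] at hHlt; exact hHlt
    · -- `(G₀, H₀) ≠ (K, L)`: the strict transforms of `K` and `L` have no common point
      intro heq
      simp only [Prod.mk.injEq] at heq
      obtain ⟨rfl, rfl⟩ := heq
      have hxT : π x' ∈ (T.sup id).support :=
        (mem_support_finsetSup_iff T _).mpr fun G' hG' => by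
          rcases (hTKL G').mp hG' with rfl | rfl
          · exact hxG₀
          · exact hxH₀
      have hxF : x' ∈ F.support := by
        show x' ∈ (F.support : Set X')
        rw [hFdef, Scheme.IdealSheafData.support_comap]
        exact hxT
      obtain ⟨G', hG'T, hG'⟩ := exists_not_mem_support_strictTransformIdeal_pw hW hTA hπ hxF
      rcases (hTKL G').mp hG'T with rfl | rfl
      · exact hG' (hG₀eq ▸ hxG)
      · exact hG' (hH₀eq ▸ hxH)
    · simp only [Prod.mk.injEq]
      exact ⟨hG₀eq.symm, hH₀eq.symm⟩
    · rw [value, value]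
      simp only
      rw [hexpG.1, hexpG.2, hexpH.1, hexpH.2]

/-- **The blow-up step, snc read at the points of the cosupport.** If some bad pair attains the maximal value
`M` on its `A`-side, blowing up the stratum of a well-chosen bad pair yields transformed exponent lists on
the (chosen) blow-up with: regular centre inside the cosupport, the same boundary for both lists, SIMPLE
NORMAL CROSSINGS OF IT AT THE POINTS OF THE NEW COSUPPORT, the total transforms of the two monomial ideals,
and a lexicographically smaller measure. [cite: Kollar2007, (3.111) Step 3] -/
theorem exists_step_pw
    (hS : ∀ x ∈ (monomialIdeal A ⊔ monomialIdeal B).support, SNCWithAt (boundaryOf A) ⊤ x)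
    (hAB : boundaryOf A = boundaryOf B)
    (hex : ∃ p ∈ badPairs A B, expOf A p.1 - expOf B p.1 = maxVal A B) :
    ∃ (C : X.IdealSheafData) (A' B' : List ((blowup C).IdealSheafData × ℕ)),
      Scheme.IsRegular C.subscheme ∧
      (C.support : Set X) ⊆ (monomialIdeal A ⊔ monomialIdeal B).support ∧
      boundaryOf A' = boundaryOf B' ∧
      (∀ x' ∈ (monomialIdeal A' ⊔ monomialIdeal B').support, SNCWithAt (boundaryOf A') ⊤ x') ∧
      (monomialIdeal A).comap (blowup.π C) = monomialIdeal A' ∧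
      (monomialIdeal B).comap (blowup.π C) = monomialIdeal B' ∧
      (maxVal A' B' < maxVal A B ∨ (maxVal A' B' = maxVal A B ∧ numMax A' B' < numMax A B)) := by
  classical
  obtain ⟨p₀, hp₀, hp₀M⟩ := hex
  set K := p₀.1 with hKdef
  -- choose `L` maximizing `b_L - a_L` among the bad partners of `K`
  set partners := (badPairs A B).filter fun p => p.1 = K with hpartners
  have hne : partners.Nonempty := ⟨p₀, Finset.mem_filter.mpr ⟨hp₀, rfl⟩⟩
  obtain ⟨p₁, hp₁, hp₁max⟩ := Finset.exists_max_image partners (fun p => expOf B p.2 - expOf A p.2) hne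
  obtain ⟨hp₁bad, hp₁K⟩ := Finset.mem_filter.mp hp₁
  set L := p₁.2 with hLdef
  have hKL : (K, L) ∈ badPairs A B := by
    have : p₁ = (K, L) := Prod.ext hp₁K rfl
    rwa [this] at hp₁bad
  have hLmax : ∀ H ∈ sheaves B, (K, H) ∈ badPairs A B → expOf B H - expOf A H ≤ expOf B L - expOf A L :=
    fun H _ hKH => hp₁max (K, H) (Finset.mem_filter.mpr ⟨hKH, rfl⟩)
  have hKM : expOf A K - expOf B K = maxVal A B := hp₀M
  have hvalKL : value A B (K, L) = maxVal A B := by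
    refine le_antisymm (value_le_maxVal hKL) ?_
    rw [value, ← hKM]
    exact le_max_left _ _
  obtain ⟨hKA, hLB, hbad⟩ := mem_badPairs_iff.mp hKL
  replace hKA : K ∈ sheaves A := hKA
  replace hLB : L ∈ sheaves B := hLB
  replace hbad : IsBadPair A B K L := hbad
  have hSAB : sheaves A = sheaves B := sheaves_eq_of_boundaryOf_eq hAB
  set T : Finset X.IdealSheafData := {K, L} with hTdef
  have hTKL : ∀ G, G ∈ T ↔ G = K ∨ G = L := fun G => by
    rw [hTdef, Finset.mem_insert, Finset.mem_singleton]
  have hTA : ∀ G ∈ T, G ∈ boundaryOf A := by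
    intro G hG
    rcases Finset.mem_insert.mp hG with rfl | hG
    · exact mem_sheaves_iff.mp hKA
    · rw [Finset.mem_singleton.mp hG]; exact mem_sheaves_iff.mp (hSAB ▸ hLB)
  have hTB : ∀ G ∈ T, G ∈ boundaryOf B := fun G hG => hAB ▸ hTA G hG
  have hW : ∀ x ∈ (T.sup id).support, SNCWithAt (boundaryOf A) ⊤ x :=
    sncWithAt_of_mem_support_finsetSup hS hKA hLB hbad hTKL
  have hWB : ∀ x ∈ (T.sup id).support, SNCWithAt (boundaryOf B) ⊤ x := hAB ▸ hW
  set C : X.IdealSheafData := T.sup id with hC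
  have hπ : IsBlowup (blowup.π C) (T.sup id) := blowup.isBlowup C
  have hCsupp : (C.support : Set X) ⊆ (monomialIdeal A ⊔ monomialIdeal B).support := by
    intro x hx
    have hx' := (mem_support_finsetSup_iff T x).mp hx
    exact mem_support_sup_of_isBadPair hKA hLB hbad (hx' K (Finset.mem_insert_self K _))
      (hx' L (Finset.mem_insert_of_mem (Finset.mem_singleton_self L)))
  have hA' := comap_monomialIdeal_eq_transformExp_pw hW hTA hπ
  have hB' := comap_monomialIdeal_eq_transformExp_pw hWB hTB hπ
  refine ⟨C, transformExp A (blowup.π C) T 0, transformExp B (blowup.π C) T 0,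
    isRegular_subscheme_finsetSup_of_sncWithAt T hTA hW, hCsupp, ?_, ?_, hA', hB', ?_⟩
  · rw [boundaryOf_transformExp, boundaryOf_transformExp, hAB]
  · -- snc of the transformed boundary at the points of the new cosupport (pv-009's transport)
    intro x' hx'
    have hxS : (blowup.π C) x' ∈ (monomialIdeal A ⊔ monomialIdeal B).support := by
      have h1 : x' ∈ (((monomialIdeal A ⊔ monomialIdeal B).comap (blowup.π C)).support : Set (blowup C)) := by
        rw [Scheme.IdealSheafData.comap_sup, hA', hB']
        exact hx'
      rw [Scheme.IdealSheafData.support_comap] at h1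
      exact h1
    rw [boundaryOf_transformExp]
    exact hπ.sncWithAt_transform x' ((hS _ hxS).finsetSup T hTA)
  · -- the measure drops
    set A' := transformExp A (blowup.π C) T 0 with hA'def
    set B' := transformExp B (blowup.π C) T 0 with hB'def
    have hcl := step_classify_pw hS hAB hKL hKM hLmax hTKL hπ
    -- every new value is `≤ M`
    have hle : maxVal A' B' ≤ maxVal A B := by
      refine Finset.sup_le fun p' hp' => ?_
      rcases hcl p' hp' with h | ⟨p, hp, -, -, hv⟩
      · exact h.le
      · rw [hv]; exact value_le_maxVal hp
    rcases hle.lt_or_eq with hlt | heq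
    · exact Or.inl hlt
    · refine Or.inr ⟨heq, ?_⟩
      -- the new pairs of value `M` come from old pairs of value `M` other than `(K, L)`
      let st : X.IdealSheafData × X.IdealSheafData → (blowup C).IdealSheafData × (blowup C).IdealSheafData :=
        fun p => (strictTransformIdeal (blowup.π C) (T.sup id) p.1,
          strictTransformIdeal (blowup.π C) (T.sup id) p.2)
      have hsub : (badPairs A' B').filter (fun p' => value A' B' p' = maxVal A' B') ⊆
          (((badPairs A B).filter fun p => value A B p = maxVal A B).erase (K, L)).image st := by
        intro p' hp'
        obtain ⟨hp'bad, hp'v⟩ := Finset.mem_filter.mp hp'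
        rcases hcl p' hp'bad with h | ⟨p, hp, hpne, hpeq, hv⟩
        · rw [hp'v, heq] at h; exact absurd h (lt_irrefl _)
        · refine Finset.mem_image.mpr
            ⟨p, Finset.mem_erase.mpr ⟨hpne, Finset.mem_filter.mpr ⟨hp, ?_⟩⟩, hpeq.symm⟩
          rw [← hv, hp'v, heq]
      rw [MonomialCleanup.numMax, MonomialCleanup.numMax]
      calc ((badPairs A' B').filter fun p' => value A' B' p' = maxVal A' B').card
          ≤ ((((badPairs A B).filter fun p => value A B p = maxVal A B).erase (K, L)).image st).card :=
            Finset.card_le_card hsub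
        _ ≤ (((badPairs A B).filter fun p => value A B p = maxVal A B).erase (K, L)).card :=
            Finset.card_image_le
        _ < ((badPairs A B).filter fun p => value A B p = maxVal A B).card :=
            Finset.card_erase_lt_of_mem (Finset.mem_filter.mpr ⟨hKL, hvalKL⟩)

end Step

end PointwisePair

end Summit.ResolutionOfSingularities.ResolutionOfSingularities.Theorems

end
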